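import Mathlib
import Summits.CriticalPhenomena.Ising3DConformalLimit.Theses.MirrorHoelderCompactness
import Summits.CriticalPhenomena.Ising3DConformalLimit.Theorems.MirrorHoelderCompactnessRescaledBounds
import HarnessLib

/-!
# `CompactnessGlue` (item stmt-CriticalPhenomena-6158, route `MirrorHoelderCompactness`)

The item: `TwoPointDoubling → SeparableHoelder → NonSeparableModulus → UniformRegularity`, the
conclusion written out verbatim — (a) local bounds, (b) asymptotic equicontinuity and (c)
non-degeneracy of the rescaled two-point function, for the critical `ℤ³` spin correlators rescaled
with the forced renormalisation `ρ★(δ) = ⟨σ₀σ_{⌊δ⁻¹⌋e₀}⟩_{β_c}^{-1/2}`,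
`F_n^δ = rescaledCorrelator (criticalCorr 3) ρ★ n δ`.

Parts (a) and (c), conditional on `TwoPointDoubling` alone, are EXACTLY the sibling support item
`RescaledBounds`, landed as `MirrorHoelderCompactnessRescaledBounds.rescaledBounds_proof`; they are
imported. Part (b) is proved here (it uses no property of `ρ★`):

* `telescoping_equicontinuity_filter` — pure topology: single-variable asymptotic equicontinuity
  (along any filter) on all compacts inside an open set implies joint asymptotic equicontinuity,
  by moving the points one at a time inside a compact closed thickening (hybrid configurations,
  telescoping sum); the filter form of `telescoping_equicontinuity` of the line
  `only-interaction-breaks-moebius` (`Theorems/EnergyNotSigmaSquaredMoebiusLimitExistsTelescoping`);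
* `single_move` — the glue proper: given `ε` and a compact `K' ⊆ NonCoincident`, take `m` from
  `NonSeparableModulus` (`ε` on `K'`), then `C, δ₀, h₀` from `SeparableHoelder` with that `m`; a
  one-point move that is `m`-separable by one of the nine mirror normals costs
  `≤ C(‖Δxᵢ‖ + δ)^{1/2} < ε` once `‖Δxᵢ‖, δ < (ε/2C)²/2`, a non-separable one `< ε`;
* `rescaled_equicontinuous` — part (b), with the filter `𝓝[>] 0` unwound to `∀ δ ∈ (0, δ₀)`
  (`eventually_nhdsGT_zero_iff`);
* `compactnessGlue_proof : CompactnessGlue` — the item.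

References: J. Glimm, A. Jaffe, *Quantum Physics* (1987), ch. 12 (regularity and compactness of
Schwinger functions); folklore real analysis (Arzelà–Ascoli bookkeeping). No definitions are
introduced.
-/

noncomputable section

namespace Summit.CriticalPhenomena.Ising3DConformalLimit.MirrorHoelderCompactnessGlue

open Literature.Probability.LatticeModels
open Summit.CriticalPhenomena.Ising3DConformalLimit.Theses.MirrorHoelderCompactness
open Filter Topology Set

/-- Eventualities at `0⁺` are statements on small intervals `(0, δ₀)`. [folklore] -/
theorem eventually_nhdsGT_zero_iff {P : ℝ → Prop} :
    (∀ᶠ δ in 𝓝[>] (0 : ℝ), P δ) ↔ ∃ δ₀ : ℝ, 0 < δ₀ ∧ ∀ δ ∈ Set.Ioo 0 δ₀, P δ := by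
  rw [Filter.Eventually, mem_nhdsGT_iff_exists_Ioo_subset]
  constructor
  · rintro ⟨u, hu, hsub⟩
    exact ⟨u, hu, fun δ hδ => hsub hδ⟩
  · rintro ⟨δ₀, hδ₀, h⟩
    exact ⟨δ₀, hδ₀, fun δ hδ => h δ hδ⟩

/-! ### Part (b): asymptotic equicontinuity from the one-point moduli -/

/-- **Telescoping: single-variable ⇒ joint asymptotic equicontinuity** (pure topology, along an
arbitrary filter `l`). For functions `F k` on `(ℝ³)ᴺ` and an open set `s`: if on every compact
`K' ⊆ s` and for every index `i` the family is `l`-asymptotically equicontinuous under moves of the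
`i`-th point alone, then it is `l`-asymptotically equicontinuous on every compact `K ⊆ s`. Hybrid
configurations inside a compact closed thickening of `K` in `s`, `N` increments each eventually
`< ε/N`, telescoping sum. Adapted verbatim from `telescoping_equicontinuity` (line
`only-interaction-breaks-moebius`, filter `atTop`). [folklore] -/
theorem telescoping_equicontinuity_filter {ι : Type*} (l : Filter ι)
    (N : ℕ) (F : ι → (Fin N → EuclideanSpace ℝ (Fin 3)) → ℝ)
    (s : Set (Fin N → EuclideanSpace ℝ (Fin 3))) (hs : IsOpen s)
    (hF : ∀ K' : Set (Fin N → EuclideanSpace ℝ (Fin 3)), IsCompact K' → K' ⊆ s →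
      ∀ i : Fin N, ∀ ε > 0, ∃ η > 0, ∀ᶠ k in l, ∀ x ∈ K', ∀ x' ∈ K',
        (∀ j, j ≠ i → x' j = x j) → dist x x' < η → |F k x - F k x'| < ε)
    (K : Set (Fin N → EuclideanSpace ℝ (Fin 3))) (hK : IsCompact K) (hKs : K ⊆ s) :
    ∀ ε > 0, ∃ η > 0, ∀ᶠ k in l, ∀ x ∈ K, ∀ y ∈ K, dist x y < η → |F k x - F k y| < ε := by
  -- adapted from Theorems/EnergyNotSigmaSquaredMoebiusLimitExistsTelescoping (`atTop` ↦ `l`)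
  intro ε hε
  rcases Nat.eq_zero_or_pos N with hN | hN
  · -- `N = 0`: the configuration space is a single point.
    subst hN
    refine ⟨1, one_pos, Filter.Eventually.of_forall fun k x _ y _ _ => ?_⟩
    have hxy : x = y := funext fun j => Fin.elim0 j
    rw [hxy, sub_self, abs_zero]
    exact hε
  -- `N ≥ 1`: a compact closed thickening `K'` of `K` inside `s`.
  obtain ⟨r, hr, hrs⟩ := hK.exists_cthickening_subset_open hs hKs
  have hK' : IsCompact (Metric.cthickening r K) := hK.cthickening
  have hNpos : (0 : ℝ) < N := by exact_mod_cast hN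
  have hεN : 0 < ε / N := div_pos hε hNpos
  choose η hη hev using fun i : Fin N => hF (Metric.cthickening r K) hK' hrs i (ε / N) hεN
  have hne : (Finset.univ : Finset (Fin N)).Nonempty := ⟨⟨0, hN⟩, Finset.mem_univ _⟩
  obtain ⟨η₀, hη₀, hη₀le⟩ : ∃ η₀ : ℝ, 0 < η₀ ∧ ∀ i, η₀ ≤ η i :=
    ⟨Finset.univ.inf' hne η, (Finset.lt_inf'_iff hne).mpr fun i _ => hη i,
      fun i => Finset.inf'_le η (Finset.mem_univ i)⟩
  refine ⟨min r η₀, lt_min hr hη₀, ?_⟩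
  have hall : ∀ᶠ k in l, ∀ i : Fin N, ∀ x ∈ Metric.cthickening r K,
      ∀ x' ∈ Metric.cthickening r K, (∀ j, j ≠ i → x' j = x j) → dist x x' < η i →
        |F k x - F k x'| < ε / N :=
    Filter.eventually_all.mpr hev
  filter_upwards [hall] with k hk
  intro x hx y hy hxy
  have hxyr : dist x y < r := lt_of_lt_of_le hxy (min_le_left _ _)
  have hxyη : dist x y < η₀ := lt_of_lt_of_le hxy (min_le_right _ _)
  -- The hybrid configurations `z l = (y₀, …, y_{l-1}, x_l, …, x_{N-1})`.
  set z : ℕ → (Fin N → EuclideanSpace ℝ (Fin 3)) := fun l j => if (j : ℕ) < l then y j else x j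
    with hz
  have hz0 : z 0 = x := by
    funext j
    simp [hz]
  have hzN : z N = y := by
    funext j
    simp [hz, j.isLt]
  have hzK' : ∀ l, z l ∈ Metric.cthickening r K := by
    intro l
    refine Metric.mem_cthickening_of_dist_le (z l) x r K hx ?_
    refine (dist_pi_le_iff hr.le).mpr fun j => ?_
    by_cases h : (j : ℕ) < l
    · simp only [hz, h, if_true]
      exact (dist_le_pi_dist y x j).trans (by rw [dist_comm]; exact hxyr.le)
    · simp only [hz, h, if_false, dist_self]
      exact hr.le
  have hzdist : ∀ l, dist (z l) (z (l + 1)) ≤ dist x y := by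
    intro l
    refine (dist_pi_le_iff dist_nonneg).mpr fun j => ?_
    by_cases h : (j : ℕ) < l
    · have h' : (j : ℕ) < l + 1 := Nat.lt_succ_of_lt h
      simp only [hz, h, h', if_true, dist_self]
      exact dist_nonneg
    · by_cases h' : (j : ℕ) < l + 1
      · simp only [hz, h, h', if_true, if_false]
        exact dist_le_pi_dist x y j
      · simp only [hz, h, h', if_false, dist_self]
        exact dist_nonneg
  have hzdiff : ∀ (l : ℕ) (hl : l < N), ∀ j : Fin N, j ≠ ⟨l, hl⟩ → z (l + 1) j = z l j := by
    intro l hl j hj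
    have hjl : (j : ℕ) ≠ l := fun h => hj (Fin.ext h)
    by_cases h : (j : ℕ) < l
    · have h' : (j : ℕ) < l + 1 := Nat.lt_succ_of_lt h
      simp only [hz, h, h', if_true]
    · have h' : ¬ (j : ℕ) < l + 1 := fun h'' => hjl (by omega)
      simp only [hz, h, h', if_false]
  have hstep : ∀ l ∈ Finset.range N, |F k (z l) - F k (z (l + 1))| < ε / N := by
    intro l hl
    rw [Finset.mem_range] at hl
    exact hk ⟨l, hl⟩ (z l) (hzK' l) (z (l + 1)) (hzK' (l + 1)) (hzdiff l hl)
      (lt_of_lt_of_le (lt_of_le_of_lt (hzdist l) hxyη) (hη₀le ⟨l, hl⟩))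
  -- Telescoping.
  have htel : F k x - F k y = ∑ l ∈ Finset.range N, (F k (z l) - F k (z (l + 1))) := by
    rw [Finset.sum_range_sub' (fun l => F k (z l)), hz0, hzN]
  calc |F k x - F k y| = |∑ l ∈ Finset.range N, (F k (z l) - F k (z (l + 1)))| := by rw [htel]
    _ ≤ ∑ l ∈ Finset.range N, |F k (z l) - F k (z (l + 1))| := Finset.abs_sum_le_sum_abs _ _
    _ < ∑ _l ∈ Finset.range N, ε / N :=
        Finset.sum_lt_sum_of_nonempty ⟨0, Finset.mem_range.mpr hN⟩ hstep
    _ = ε := by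
        rw [Finset.sum_const, Finset.card_range, nsmul_eq_mul]
        field_simp

/-- **One-point moves** (the case split of the glue). Under `TwoPointDoubling`, `SeparableHoelder`
and `NonSeparableModulus`: on every compact `K'` of non-coincident configurations, for every index
`i` and `ε > 0` there is `η > 0` such that for all small `δ` and `x, x' ∈ K'` differing only in the
`i`-th point, by less than `η`, `|F_N^δ(x) − F_N^δ(x')| < ε`. Take `m` from `NonSeparableModulus`
(`ε` on `K'`), then `C, δ₀, h₀` from `SeparableHoelder` with that `m`; a nine-mirror `m`-separable
move costs `≤ C(‖x'ᵢ − xᵢ‖ + δ)^{1/2} < ε` for `η, δ` small, a non-separable one `< ε`. [folklore] -/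
theorem single_move (hD : TwoPointDoubling) (hSH : SeparableHoelder) (hNS : NonSeparableModulus)
    (N : ℕ) (K' : Set (Fin N → EuclideanSpace ℝ (Fin 3))) (hK'c : IsCompact K')
    (hK' : K' ⊆ NonCoincident 3 N) (i : Fin N) (ε : ℝ) (hε : 0 < ε) :
    ∃ η > 0, ∀ᶠ δ in 𝓝[>] (0 : ℝ), ∀ x ∈ K', ∀ x' ∈ K', (∀ j, j ≠ i → x' j = x j) →
      dist x x' < η →
        |rescaledCorrelator (criticalCorr 3)
            (fun δ : ℝ => (criticalTwoPoint 3 (Pi.single 0 ⌊δ⁻¹⌋)) ^ (-(1/2:ℝ))) N δ x -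
          rescaledCorrelator (criticalCorr 3)
            (fun δ : ℝ => (criticalTwoPoint 3 (Pi.single 0 ⌊δ⁻¹⌋)) ^ (-(1/2:ℝ))) N δ x'| < ε := by
  obtain ⟨m, η₁, δ₁, hm, hη₁, hδ₁, hN⟩ := hNS N K' hK' hK'c ε hε
  obtain ⟨C, δ₂, h₀, hδ₂, hh₀, hS⟩ := hSH hD N K' hK' hK'c m hm
  -- constants
  set C' : ℝ := max C 1 with hC'
  have hC'pos : 0 < C' := lt_of_lt_of_le one_pos (le_max_right _ _)
  have hCC' : C ≤ C' := le_max_left _ _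
  set τ : ℝ := (ε / (2 * C')) ^ 2 / 2 with hτ
  have hτpos : 0 < τ := by positivity
  have hτroot : C' * (2 * τ) ^ (1 / 2 : ℝ) = ε / 2 := by
    have h2τ : 2 * τ = (ε / (2 * C')) ^ 2 := by rw [hτ]; ring
    rw [h2τ, ← Real.sqrt_eq_rpow, Real.sqrt_sq (by positivity)]
    field_simp
  -- logical combination of the two cases
  have hcomb : ∀ {P : Prop} {a b e : ℝ}, (P → a ≤ b) → (¬ P → a < e) → b < e → a < e := by
    intro P a b e h1 h2 h3
    by_cases hP : P
    · exact (h1 hP).trans_lt h3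
    · exact h2 hP
  refine ⟨min η₁ (min h₀ τ), lt_min hη₁ (lt_min hh₀ hτpos), ?_⟩
  have hev : ∀ᶠ δ in 𝓝[>] (0 : ℝ), δ ∈ Set.Ioo 0 (min δ₁ (min δ₂ τ)) :=
    eventually_nhdsGT_zero_iff.2 ⟨min δ₁ (min δ₂ τ), lt_min hδ₁ (lt_min hδ₂ hτpos), fun δ hδ => hδ⟩
  filter_upwards [hev] with δ hδ
  intro x hx x' hx' hdiff hdist
  have hδ₁' : δ ∈ Set.Ioo 0 δ₁ := ⟨hδ.1, hδ.2.trans_le (min_le_left _ _)⟩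
  have hδ₂' : δ ∈ Set.Ioo 0 δ₂ := ⟨hδ.1, (hδ.2.trans_le (min_le_right _ _)).trans_le (min_le_left _ _)⟩
  have hδτ : δ < τ := (hδ.2.trans_le (min_le_right _ _)).trans_le (min_le_right _ _)
  -- `x'` is `x` with the `i`-th point moved
  have hupd : Function.update x i (x' i) = x' := by
    funext j
    by_cases hj : j = i
    · subst hj
      rw [Function.update_self]
    · rw [Function.update_of_ne hj, hdiff j hj]
  have hmove : ‖x' i - x i‖ < min η₁ (min h₀ τ) := by
    calc ‖x' i - x i‖ = dist (x' i) (x i) := (dist_eq_norm _ _).symm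
      _ ≤ dist x' x := dist_le_pi_dist x' x i
      _ = dist x x' := dist_comm _ _
      _ < min η₁ (min h₀ τ) := hdist
  have hη₁' : ‖x' i - x i‖ < η₁ := hmove.trans_le (min_le_left _ _)
  have hh₀' : ‖x' i - x i‖ ≤ h₀ := (hmove.trans_le ((min_le_right _ _).trans (min_le_left _ _))).le
  have hτ' : ‖x' i - x i‖ < τ := hmove.trans_le ((min_le_right _ _).trans (min_le_right _ _))
  have hS' := hS δ hδ₂' x hx i (x' i) hh₀'
  have hN' := hN δ hδ₁' x hx i (x' i) hη₁'
  rw [hupd] at hS' hN'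
  rw [abs_sub_comm]
  refine hcomb hS' hN' ?_
  -- `C (‖x' i - x i‖ + δ)^{1/2} ≤ C' (2τ)^{1/2} = ε/2 < ε`
  have hbase : 0 ≤ ‖x' i - x i‖ + δ := add_nonneg (norm_nonneg _) hδ.1.le
  have hle2τ : ‖x' i - x i‖ + δ ≤ 2 * τ := by linarith
  calc C * (‖x' i - x i‖ + δ) ^ (1 / 2 : ℝ) ≤ C' * (‖x' i - x i‖ + δ) ^ (1 / 2 : ℝ) :=
        mul_le_mul_of_nonneg_right hCC' (Real.rpow_nonneg hbase _)
    _ ≤ C' * (2 * τ) ^ (1 / 2 : ℝ) :=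
        mul_le_mul_of_nonneg_left (Real.rpow_le_rpow hbase hle2τ (by norm_num)) hC'pos.le
    _ = ε / 2 := hτroot
    _ < ε := half_lt_self hε

/-- **Part (b): asymptotic equicontinuity** under `TwoPointDoubling`, `SeparableHoelder` and
`NonSeparableModulus`: for every `n`, every compact `K` of non-coincident configurations and every
`ε > 0` there are `r, δ₀ > 0` with `|F_n^δ(x) − F_n^δ(y)| < ε` for `δ < δ₀`, `x, y ∈ K`,
`dist x y < r` — the one-point moves (`single_move`) telescoped across a compact thickening of
`K` inside `NonCoincident` (`telescoping_equicontinuity_filter`). [folklore] -/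
theorem rescaled_equicontinuous (hD : TwoPointDoubling) (hSH : SeparableHoelder)
    (hNS : NonSeparableModulus) (n : ℕ) (K : Set (Fin n → EuclideanSpace ℝ (Fin 3)))
    (hK : K ⊆ NonCoincident 3 n) (hKc : IsCompact K) :
    ∀ ε : ℝ, 0 < ε → ∃ r δ₀ : ℝ, 0 < r ∧ 0 < δ₀ ∧ ∀ δ ∈ Set.Ioo 0 δ₀, ∀ x ∈ K, ∀ y ∈ K,
      dist x y < r →
        |rescaledCorrelator (criticalCorr 3)
            (fun δ : ℝ => (criticalTwoPoint 3 (Pi.single 0 ⌊δ⁻¹⌋)) ^ (-(1/2:ℝ))) n δ x -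
          rescaledCorrelator (criticalCorr 3)
            (fun δ : ℝ => (criticalTwoPoint 3 (Pi.single 0 ⌊δ⁻¹⌋)) ^ (-(1/2:ℝ))) n δ y| < ε := by
  intro ε hε
  have h := telescoping_equicontinuity_filter (𝓝[>] (0 : ℝ)) n
    (fun δ x => rescaledCorrelator (criticalCorr 3)
      (fun δ : ℝ => (criticalTwoPoint 3 (Pi.single 0 ⌊δ⁻¹⌋)) ^ (-(1/2:ℝ))) n δ x)
    (NonCoincident 3 n) (isOpen_nonCoincident 3 n)
    (fun K' hK'c hK' i ε' hε' => single_move hD hSH hNS n K' hK'c hK' i ε' hε') K hKc hK ε hε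
  obtain ⟨η, hη, hev⟩ := h
  obtain ⟨δ₀, hδ₀, h'⟩ := eventually_nhdsGT_zero_iff.1 hev
  exact ⟨η, δ₀, hη, hδ₀, h'⟩

/-! ### The item -/

/-- **Item stmt-CriticalPhenomena-6158 (`CompactnessGlue`, route `MirrorHoelderCompactness`).**
`TwoPointDoubling → SeparableHoelder → NonSeparableModulus → UniformRegularity` (conclusion written
out verbatim): parts (a) (local bounds at all orders) and (c) (non-degeneracy of the rescaled
two-point function) are the landed sibling `RescaledBounds` applied to `TwoPointDoubling`
(`MirrorHoelderCompactnessRescaledBounds.rescaledBounds_proof`: doubling + Messager–Miracle-Solé +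
Newman's Gaussian inequality); part (b) (asymptotic equicontinuity) is `rescaled_equicontinuous`:
one-point moves, separable ones by `SeparableHoelder`, caged ones by `NonSeparableModulus`,
telescoped inside a compact thickening of `K` in `NonCoincident`. [folklore] -/
theorem compactnessGlue_proof : CompactnessGlue := by
  intro hD hSH hNS
  obtain ⟨ha, hc⟩ := MirrorHoelderCompactnessRescaledBounds.rescaledBounds_proof hD
  exact ⟨fun n K hK hKc => ⟨ha n K hK hKc, rescaled_equicontinuous hD hSH hNS n K hK hKc⟩, hc⟩

end Summit.CriticalPhenomena.Ising3DConformalLimit.MirrorHoelderCompactnessGlue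

end
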